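import Literature.Probability.LatticeModels.DobrushinShlosmanSuperSolutionStates
import Literature.Probability.LatticeModels.ONModelDobrushinStates
import HarnessLib

/-!
# The Dobrushin–Shlosman window comparison under the per-window received sum for the CONDITIONAL specification:
# covariance decay and boundary insensitivity of the finite-volume kernels at the GEOMETRIC rate (interior form)

Topic `Literature/Probability/LatticeModels`; theorems only (no definition, no named fact). The kernel twin of
`DobrushinShlosmanSuperSolutionStates.abs_covariance_le_of_window_geometric`: the two-functional engine
`abs_sub_le_of_window_geometric_exp` (Föllmer's super-solution argument under the PER-WINDOW received sum `≤ γ₀ < 1`, rate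
`γ₀^{L₀}` along an `ℕ`-profile) run with `E₁ = γ_Λ(· | η)` — a Gibbs measure of Föllmer's conditional specification `π^{Λ,η}`
(1988, Ch. I, (2.10)) — and `E₂` its tilt by the shifted density `g̃`, both invariant under the window kernels `γ_{win c}`,
`nbhd c ⊆ Λ`, avoiding the support of `g` (CONSISTENCY instead of DLR; properness).

* `abs_covariance_kernel_le_of_window_geometric` — `|cov_{γ_Λ(·|η)}(f, g)| ≤ 2 R² γ₀^{L₀} (Σ δf)(Σ δg)` for every finite `Λ`, every
  `η` and every adapted profile `ℓ ≥ L₀` on `Δf`: the sharper, geometric companion of `DobrushinShlosmanKernel.lean`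
  (rate `(1−γ₀)²/(2(2γ₀N⋆+1))`).
* `abs_integral_sub_integral_le_of_window_geometric` — `|∫F dγ_Λ(·|ω) − ∫F dγ_Λ(·|η)| ≤ R γ₀^{L₀} Σ_{Λ} δ` for every profile
  vanishing on the support of `δ` below `L₀`: the geometric companion of
  `DobrushinShlosmanUniqueness.abs_integral_sub_integral_le_of_window` (`E₁`, `E₂` the two kernels; consistency).

References: H. Föllmer, LNM 1362 (1988), Ch. I, (2.7)–(2.11), Thm. (2.8), Thm. (2.13); R. L. Dobrushin, S. B. Shlosman (1985), Thm. 1;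
H.-O. Georgii (2011) §8.2; the tree files `DobrushinShlosmanSuperSolutionStates.lean` (followed line by line),
`DobrushinShlosmanSuperSolutionInfiniteVolume.lean`.
-/

noncomputable section

open MeasureTheory ProbabilityTheory Finset Function Filter
open scoped Topology
open Literature.Probability.LatticeModels.DobrushinMetric (IsLipBound integrable_of_abs_le'
  abs_sub_le_mul_sum_of_dependsOn)

namespace Literature.Probability.LatticeModels.DobrushinShlosman

variable {V S : Type*} [MeasurableSpace S]

/-- **Covariance decay of the finite-volume KERNELS at the GEOMETRIC rate under the per-window received sum, arbitrary index
set, interior form** (Föllmer 1988 Ch. I (2.7)–(2.11) with Thm. (2.13) for the conditional specification (2.10); Dobrushin–Shlosman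
1985 Thm. 1). Window data as in `abs_covariance_le_of_window_geometric`; for EVERY finite `Λ`, EVERY boundary condition `η`, bounded
measurable `f, g` reading `Δf ⊆ Λ`, `Δg` with site-Lipschitz vectors, and a profile `ℓ ≥ L₀` on `Δf` such that every window through a
site of positive profile has `c ∈ Λ`, `nbhd c ⊆ Λ` and avoids `Δg`, and `ℓ` drops by at most one along the support of `K`:
`|cov_{γ_Λ(·|η)}(f, g)| ≤ 2 R² γ₀^{L₀} (Σ δf)(Σ δg)` — the tilt trick with `E₁ = γ_Λ(·|η)`, `E₂` its tilt, both invariant under the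
usable window kernels by CONSISTENCY and properness; compare the Dobrushin–Shlosman rate of `abs_covariance_kernel_le_of_window`.
[cite: Follmer1988, Ch. I Theorem (2.13)] [cite: DobrushinShlosman1985, Theorem 1] -/
theorem abs_covariance_kernel_le_of_window_geometric [DecidableEq V] {γ : Specification V S} (hγ : IsSpecification γ)
    {r : S → S → ℝ} {R : ℝ} (hr0 : ∀ a b, 0 ≤ r a b) (hrR : ∀ a b, r a b ≤ R) (hR : 0 ≤ R)
    {win nbhd : V → Finset V} {K : V → V → V → ℝ} (hK0 : ∀ c y x, 0 ≤ K c y x)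
    (hself : ∀ c, c ∈ win c) (hwin : ∀ c, win c ⊆ nbhd c)
    (hKsupp : ∀ c y x, K c y x ≠ 0 → y ∈ nbhd c)
    (hcontract : ∀ (c y : V), y ∉ win c → ∀ (ω η : V → S), (∀ v, v ≠ y → ω v = η v) →
      ∀ (f : (V → S) → ℝ) (δ : V → ℝ), Measurable f → (∃ B, ∀ σ, |f σ| ≤ B) →
        DependsOn f (win c : Set V) → (∀ x, 0 ≤ δ x) →
        (∀ (x : V) (σ τ : V → S), (∀ v, v ≠ x → σ v = τ v) → |f σ - f τ| ≤ δ x * r (σ x) (τ x)) →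
          |∫ σ, f σ ∂(γ (win c) ω) - ∫ σ, f σ ∂(γ (win c) η)| ≤
            (∑ x ∈ win c, K c y x * δ x) * r (ω y) (η y))
    (hloc : ∀ (c : V) (ζ ζ' : V → S), (∀ v ∈ nbhd c, ζ v = ζ' v) →
      ∀ (f : (V → S) → ℝ), Measurable f → (∃ B, ∀ σ, |f σ| ≤ B) → DependsOn f (win c : Set V) →
        ∫ σ, f σ ∂(γ (win c) ζ) = ∫ σ, f σ ∂(γ (win c) ζ'))
    {γ₀ : ℝ} (hγ₀ : 0 ≤ γ₀) (hγ₁ : γ₀ < 1)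
    (hsum : ∀ c, ∀ x ∈ win c, ∑ y ∈ nbhd c, K c y x ≤ γ₀)
    (Λ : Finset V) (η : V → S) {f g : (V → S) → ℝ} (hfm : Measurable f)
    (hgm : Measurable g) {Bf Bg : ℝ} (hBf : ∀ σ, |f σ| ≤ Bf) (hBg : ∀ σ, |g σ| ≤ Bg)
    {Δf Δg : Finset V} (hfdep : DependsOn f (Δf : Set V)) (hgdep : DependsOn g (Δg : Set V))
    {δf δg : V → ℝ} (hδf : IsLipBound r f δf) (hδg : IsLipBound r g δg)
    (hΔf : Δf ⊆ Λ) (ℓ : V → ℕ) (L₀ : ℕ)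
    (hU : ∀ x, ℓ x ≠ 0 → ∀ c, x ∈ win c → c ∈ Λ ∧ nbhd c ⊆ Λ ∧ ∀ z ∈ win c, z ∉ Δg)
    (hℓ : ∀ c x y, x ∈ win c → K c y x ≠ 0 → ℓ x ≤ ℓ y + 1) (hL : ∀ x ∈ Δf, L₀ ≤ ℓ x) :
    |cov[f, g; γ Λ η]| ≤ 2 * R ^ 2 * γ₀ ^ L₀ * (∑ x ∈ Δf, δf x) * ∑ y ∈ Δg, δg y := by
  -- adapted from `DobrushinShlosman.abs_covariance_le_of_window` (closing with the geometric comparison)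
  classical
  haveI := hγ.isProbability Λ η
  set μ : Measure (V → S) := γ Λ η with hμdef
  obtain ⟨τ₀, -⟩ := nonempty_of_measure_ne_zero (μ := μ) (s := Set.univ) (by simp)
  -- the shifted density `g̃ ∈ [0, 2 S_g]`
  set Sg : ℝ := R * ∑ y ∈ Δg, δg y with hSg
  have hSg0 : 0 ≤ Sg := mul_nonneg hR (Finset.sum_nonneg fun y _ => hδg.nonneg y)
  have hosc : ∀ σ, |g σ - g τ₀| ≤ Sg := fun σ => abs_sub_le_mul_sum_of_dependsOn hrR hgdep hδg σ τ₀
  set gt : (V → S) → ℝ := fun σ => g σ + (Sg - g τ₀) with hgt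
  have hgt0 : ∀ σ, 0 ≤ gt σ := fun σ => by
    have := (abs_le.1 (hosc σ)).1; simp only [hgt]; linarith
  have hgtB : ∀ σ, gt σ ≤ 2 * Sg := fun σ => by
    have := (abs_le.1 (hosc σ)).2; simp only [hgt]; linarith
  have hgtm : Measurable gt := hgm.add_const _
  have hgtdep : DependsOn gt (Δg : Set V) := fun σ τ h => by
    simp only [hgt]; rw [hgdep h]
  have hgi : Integrable g μ := integrable_of_abs_le' hgm hBg
  have hfi : Integrable f μ := integrable_of_abs_le' hfm hBf
  have hgtabs : ∀ σ, |gt σ| ≤ 2 * Sg := fun σ => by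
    rw [abs_of_nonneg (hgt0 σ)]; exact hgtB σ
  have hgti : Integrable gt μ := integrable_of_abs_le' hgtm hgtabs
  -- the right-hand side is nonnegative
  have hRHS : 0 ≤ 2 * R ^ 2 * γ₀ ^ L₀ * (∑ x ∈ Δf, δf x) * ∑ y ∈ Δg, δg y := by
    have := Finset.sum_nonneg fun x (_ : x ∈ Δf) => hδf.nonneg x
    have := Finset.sum_nonneg fun y (_ : y ∈ Δg) => hδg.nonneg y
    have := pow_nonneg hγ₀ L₀
    positivity
  -- `cov(f, g) = cov(f, g̃) = μ(f g̃) - μ(f) μ(g̃)`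
  have hcov : cov[f, g; μ] = ∫ σ, f σ * gt σ ∂μ - (∫ σ, f σ ∂μ) * ∫ σ, gt σ ∂μ := by
    have h1 : cov[f, g; μ] = cov[f, gt; μ] := by
      rw [hgt, covariance_add_const_right hgi]
    rw [h1, covariance_eq_sub]
    · rfl
    · exact memLp_of_bounded (a := -Bf) (b := Bf)
        (ae_of_all _ fun σ => abs_le.1 (hBf σ)) hfm.aestronglyMeasurable 2
    · exact memLp_of_bounded (a := -(2 * Sg)) (b := 2 * Sg)
        (ae_of_all _ fun σ => abs_le.1 (hgtabs σ)) hgtm.aestronglyMeasurable 2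
  by_cases hz : ∫ σ, gt σ ∂μ = 0
  · -- degenerate case: `g̃ = 0` a.e., so the covariance vanishes
    have hae : gt =ᵐ[μ] 0 := (integral_eq_zero_iff_of_nonneg (fun σ => hgt0 σ) hgti).1 hz
    have hfg : ∫ σ, f σ * gt σ ∂μ = 0 := by
      rw [← integral_zero (α := V → S) (μ := μ) (G := ℝ)]
      refine integral_congr_ae ?_
      filter_upwards [hae] with σ hσ
      simp [hσ]
    rw [hcov, hfg, hz, mul_zero, sub_zero, abs_zero]
    exact hRHS
  have hpos : 0 < ∫ σ, gt σ ∂μ := lt_of_le_of_ne (integral_nonneg hgt0) (Ne.symm hz)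
  -- the two functionals: `μ` and its tilt by `g̃`; usable = windows inside `Λ` avoiding `Δg`
  have hgfi : ∀ {F : (V → S) → ℝ}, Measurable F → ∀ {B : ℝ}, (∀ σ, |F σ| ≤ B) →
      Integrable (fun σ => gt σ * F σ) μ := fun hFm B hB =>
    hgti.mul_bdd hFm.aestronglyMeasurable (ae_of_all _ fun σ => by rw [Real.norm_eq_abs]; exact hB σ)
  have h₁le : ∀ ⦃F : (V → S) → ℝ⦄ ⦃M : ℝ⦄, Measurable F → (∃ B, ∀ σ, |F σ| ≤ B) →
      DependsOn F (Λ : Set V) → (∀ σ, F σ ≤ M) → ∫ σ, F σ ∂μ ≤ M := by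
    rintro F M hFm ⟨B, hB⟩ - hM
    calc ∫ σ, F σ ∂μ ≤ ∫ _σ, M ∂μ := integral_mono (integrable_of_abs_le' hFm hB) (integrable_const M) hM
      _ = M := by simp
  have h₁ge : ∀ ⦃F : (V → S) → ℝ⦄ ⦃M : ℝ⦄, Measurable F → (∃ B, ∀ σ, |F σ| ≤ B) →
      DependsOn F (Λ : Set V) → (∀ σ, M ≤ F σ) → M ≤ ∫ σ, F σ ∂μ := by
    rintro F M hFm ⟨B, hB⟩ - hM
    calc M = ∫ _σ, M ∂μ := by simp
      _ ≤ ∫ σ, F σ ∂μ := integral_mono (integrable_const M) (integrable_of_abs_le' hFm hB) hM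
  have h₁T : ∀ c, c ∈ Λ → nbhd c ⊆ Λ → (∀ z ∈ win c, z ∉ Δg) → ∀ ⦃F : (V → S) → ℝ⦄, Measurable F →
      (∃ B, ∀ σ, |F σ| ≤ B) → DependsOn F (Λ : Set V) →
        ∫ σ, (fun σ => ∫ τ, F τ ∂(γ (win c) σ)) σ ∂μ = ∫ σ, F σ ∂μ := by
    rintro c - hnb - F hFm ⟨B, hB⟩ -
    exact hγ.integral_integral_consistent ((hwin c).trans hnb) η (integrable_of_abs_le' hFm hB)
  have h₂le : ∀ ⦃F : (V → S) → ℝ⦄ ⦃M : ℝ⦄, Measurable F → (∃ B, ∀ σ, |F σ| ≤ B) →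
      DependsOn F (Λ : Set V) → (∀ σ, F σ ≤ M) → (∫ σ, gt σ * F σ ∂μ) / ∫ σ, gt σ ∂μ ≤ M := by
    rintro F M hFm ⟨B, hB⟩ - hM
    rw [div_le_iff₀ hpos]
    calc ∫ σ, gt σ * F σ ∂μ ≤ ∫ σ, gt σ * M ∂μ :=
          integral_mono (hgfi hFm hB) (hgti.mul_const M) fun σ => mul_le_mul_of_nonneg_left (hM σ) (hgt0 σ)
      _ = M * ∫ σ, gt σ ∂μ := by rw [integral_mul_const, mul_comm]
  have h₂ge : ∀ ⦃F : (V → S) → ℝ⦄ ⦃M : ℝ⦄, Measurable F → (∃ B, ∀ σ, |F σ| ≤ B) →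
      DependsOn F (Λ : Set V) → (∀ σ, M ≤ F σ) → M ≤ (∫ σ, gt σ * F σ ∂μ) / ∫ σ, gt σ ∂μ := by
    rintro F M hFm ⟨B, hB⟩ - hM
    rw [le_div_iff₀ hpos]
    calc M * ∫ σ, gt σ ∂μ = ∫ σ, gt σ * M ∂μ := by rw [integral_mul_const, mul_comm]
      _ ≤ ∫ σ, gt σ * F σ ∂μ :=
          integral_mono (hgti.mul_const M) (hgfi hFm hB) fun σ => mul_le_mul_of_nonneg_left (hM σ) (hgt0 σ)
  have h₂T : ∀ c, c ∈ Λ → nbhd c ⊆ Λ → (∀ z ∈ win c, z ∉ Δg) → ∀ ⦃F : (V → S) → ℝ⦄, Measurable F →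
      (∃ B, ∀ σ, |F σ| ≤ B) → DependsOn F (Λ : Set V) →
        (∫ σ, gt σ * (fun σ => ∫ τ, F τ ∂(γ (win c) σ)) σ ∂μ) / ∫ σ, gt σ ∂μ =
          (∫ σ, gt σ * F σ ∂μ) / ∫ σ, gt σ ∂μ := by
    rintro c - hnb hc F hFm ⟨B, hB⟩ -
    congr 1
    have hmul : ∀ η, gt η * (∫ τ, F τ ∂(γ (win c) η)) = ∫ τ, gt τ * F τ ∂(γ (win c) η) := fun η =>
      mul_windowAvg_eq_of_dependsOn hγ (cell := id) (Λ := win c) (W := win c) (fun v => Iff.rfl)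
        (g := gt) (Δg := Δg) hgtdep hc F η
    simp_rw [hmul]
    exact hγ.integral_integral_consistent ((hwin c).trans hnb) η (hgfi hFm hB)
  -- the geometric comparison theorem for `f` with its Lipschitz vector cut down to `Δf`
  have hfdepΛ : DependsOn f (Λ : Set V) :=
    hfdep.mono fun v hv => Finset.mem_coe.2 (hΔf (Finset.mem_coe.1 hv))
  have hδL : ∀ x, ℓ x < L₀ → (fun x => if x ∈ Δf then δf x else 0) x = 0 := fun x hx => by
    dsimp only
    split_ifs with hxΔ
    · exact absurd (hL x hxΔ) (not_le.2 hx)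
    · rfl
  have key := abs_sub_le_of_window_geometric_exp hγ hr0 hrR hR hK0 hself hwin hKsupp hcontract hloc hγ₀ hγ₁ hsum
    Λ τ₀ (fun c => ∀ z ∈ win c, z ∉ Δg) (E₁ := fun F => ∫ σ, F σ ∂μ)
    (E₂ := fun F => (∫ σ, gt σ * F σ ∂μ) / ∫ σ, gt σ ∂μ) h₁le h₁ge h₁T h₂le h₂ge h₂T ℓ L₀ hU hℓ
    hfm hBf hfdepΛ (hδf.restrict hfdep) hδL
  have hs : ∑ x ∈ Λ, (if x ∈ Δf then δf x else 0) = ∑ x ∈ Δf, δf x := by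
    rw [Finset.sum_ite_mem, Finset.inter_eq_right.2 hΔf]
  rw [hs] at key
  change |∫ σ, f σ ∂μ - (∫ σ, gt σ * f σ ∂μ) / ∫ σ, gt σ ∂μ| ≤ R * γ₀ ^ L₀ * ∑ x ∈ Δf, δf x at key
  -- `cov = μ(g̃) · (μ_{g̃}(f) - μ(f))`
  have hfgt : ∫ σ, f σ * gt σ ∂μ = ∫ σ, gt σ * f σ ∂μ :=
    integral_congr_ae (ae_of_all _ fun σ => mul_comm _ _)
  have hident : cov[f, g; μ] =
      (∫ σ, gt σ ∂μ) * ((∫ σ, gt σ * f σ ∂μ) / ∫ σ, gt σ ∂μ - ∫ σ, f σ ∂μ) := by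
    rw [hcov, hfgt, mul_sub, mul_div_cancel₀ _ hz]
    ring
  rw [hident, abs_mul, abs_of_pos hpos, abs_sub_comm]
  have hgtint : ∫ σ, gt σ ∂μ ≤ 2 * Sg := by
    calc ∫ σ, gt σ ∂μ ≤ ∫ _σ, 2 * Sg ∂μ := integral_mono hgti (integrable_const _) hgtB
      _ = 2 * Sg := by simp
  have hexp : 0 ≤ R * γ₀ ^ L₀ * ∑ x ∈ Δf, δf x := by
    have := Finset.sum_nonneg fun x (_ : x ∈ Δf) => hδf.nonneg x
    have := pow_nonneg hγ₀ L₀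
    positivity
  calc (∫ σ, gt σ ∂μ) * |∫ σ, f σ ∂μ - (∫ σ, gt σ * f σ ∂μ) / ∫ σ, gt σ ∂μ|
      ≤ (2 * Sg) * (R * γ₀ ^ L₀ * ∑ x ∈ Δf, δf x) :=
        mul_le_mul hgtint key (abs_nonneg _) (by positivity)
    _ = 2 * R ^ 2 * γ₀ ^ L₀ * (∑ x ∈ Δf, δf x) * ∑ y ∈ Δg, δg y := by
        rw [hSg]; ring

/-! ### Boundary insensitivity of the finite-volume kernels at the geometric rate -/

/-- **Kernel boundary insensitivity under the window condition, geometric rate** (Dobrushin–Shlosman 1985,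
Thm. 1 in the Vasserstein form, run on the window operators inside `Λ`; Föllmer 1988 (2.10): consistency of
the specification replaces the DLR equations for the two kernels `γ_Λ(·|ω)`, `γ_Λ(·|η)`, which are both
invariant under every window kernel `γ_{W(c)}` with `W(c) ⊆ U(c) ⊆ Λ`): if the Lipschitz vector `δ` of a bounded
`Λ`-local observable `F` vanishes below depth `L₀` of an admissible profile `ℓ` (positive only on sites all of
whose windows lie, together with their reading neighbourhoods, inside `Λ`; dropping by at most one along the
window arrays), then `|∫F dγ_Λ(·|ω) − ∫F dγ_Λ(·|η)| ≤ R γ₀^{L₀} Σ_{x ∈ Λ} δ x` — the rate `exp(−κ₁ L₀)` of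
`abs_integral_sub_integral_le_of_window` improved to `γ₀^{L₀}`, with no window-multiplicity constant.
[cite: Follmer1988, Ch. I (2.8), (2.10)] -/
theorem abs_integral_sub_integral_le_of_window_geometric [DecidableEq V] {γ : Specification V S}
    (hγ : IsSpecification γ)
    {r : S → S → ℝ} {R : ℝ} (hr0 : ∀ a b, 0 ≤ r a b) (hrR : ∀ a b, r a b ≤ R) (hR : 0 ≤ R)
    {win nbhd : V → Finset V} {K : V → V → V → ℝ} (hK0 : ∀ c y x, 0 ≤ K c y x)
    (hself : ∀ c, c ∈ win c) (hwin : ∀ c, win c ⊆ nbhd c)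
    (hKsupp : ∀ c y x, K c y x ≠ 0 → y ∈ nbhd c)
    (hcontract : ∀ (c y : V), y ∉ win c → ∀ (ω η : V → S), (∀ v, v ≠ y → ω v = η v) →
      ∀ (f : (V → S) → ℝ) (δ : V → ℝ), Measurable f → (∃ B, ∀ σ, |f σ| ≤ B) →
        DependsOn f (win c : Set V) → (∀ x, 0 ≤ δ x) →
        (∀ (x : V) (σ τ : V → S), (∀ v, v ≠ x → σ v = τ v) → |f σ - f τ| ≤ δ x * r (σ x) (τ x)) →
          |∫ σ, f σ ∂(γ (win c) ω) - ∫ σ, f σ ∂(γ (win c) η)| ≤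
            (∑ x ∈ win c, K c y x * δ x) * r (ω y) (η y))
    (hloc : ∀ (c : V) (ζ ζ' : V → S), (∀ v ∈ nbhd c, ζ v = ζ' v) →
      ∀ (f : (V → S) → ℝ), Measurable f → (∃ B, ∀ σ, |f σ| ≤ B) → DependsOn f (win c : Set V) →
        ∫ σ, f σ ∂(γ (win c) ζ) = ∫ σ, f σ ∂(γ (win c) ζ'))
    {γ₀ : ℝ} (hγ₀ : 0 ≤ γ₀) (hγ₁ : γ₀ < 1)
    (hsum : ∀ c, ∀ x ∈ win c, ∑ y ∈ nbhd c, K c y x ≤ γ₀)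
    (Λ : Finset V) (ω η : V → S) (ℓ : V → ℕ) (L₀ : ℕ)
    (hU : ∀ x, ℓ x ≠ 0 → ∀ c, x ∈ win c → c ∈ Λ ∧ nbhd c ⊆ Λ)
    (hℓ : ∀ c x y, x ∈ win c → K c y x ≠ 0 → ℓ x ≤ ℓ y + 1)
    {F : (V → S) → ℝ} (hFm : Measurable F) {B : ℝ} (hB : ∀ σ, |F σ| ≤ B)
    (hFdep : DependsOn F (Λ : Set V)) {δ : V → ℝ} (hδ : IsLipBound r F δ)
    (hδL : ∀ x, ℓ x < L₀ → δ x = 0) :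
    |∫ σ, F σ ∂(γ Λ ω) - ∫ σ, F σ ∂(γ Λ η)| ≤ R * γ₀ ^ L₀ * ∑ x ∈ Λ, δ x := by
  -- the kernels are monotone-normalised functionals on the admissible observables
  have hle : ∀ (ζ : V → S) ⦃G : (V → S) → ℝ⦄ ⦃M : ℝ⦄, Measurable G → (∃ B, ∀ σ, |G σ| ≤ B) →
      DependsOn G (Λ : Set V) → (∀ σ, G σ ≤ M) → ∫ σ, G σ ∂(γ Λ ζ) ≤ M := by
    rintro ζ G M hGm ⟨B', hB'⟩ - hM
    haveI := hγ.isProbability Λ ζ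
    calc ∫ σ, G σ ∂(γ Λ ζ) ≤ ∫ _σ, M ∂(γ Λ ζ) :=
          integral_mono (integrable_of_abs_le' hGm hB') (integrable_const M) hM
      _ = M := by simp
  have hge : ∀ (ζ : V → S) ⦃G : (V → S) → ℝ⦄ ⦃M : ℝ⦄, Measurable G → (∃ B, ∀ σ, |G σ| ≤ B) →
      DependsOn G (Λ : Set V) → (∀ σ, M ≤ G σ) → M ≤ ∫ σ, G σ ∂(γ Λ ζ) := by
    rintro ζ G M hGm ⟨B', hB'⟩ - hM
    haveI := hγ.isProbability Λ ζ
    calc M = ∫ _σ, M ∂(γ Λ ζ) := by simp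
      _ ≤ ∫ σ, G σ ∂(γ Λ ζ) := integral_mono (integrable_const M) (integrable_of_abs_le' hGm hB') hM
  -- and invariant under the window kernels inside `Λ` (consistency of the specification)
  have hT : ∀ (ζ : V → S) (c : V), c ∈ Λ → nbhd c ⊆ Λ → True → ∀ ⦃G : (V → S) → ℝ⦄, Measurable G →
      (∃ B, ∀ σ, |G σ| ≤ B) → DependsOn G (Λ : Set V) →
        ∫ σ, (fun σ => ∫ τ, G τ ∂(γ (win c) σ)) σ ∂(γ Λ ζ) = ∫ σ, G σ ∂(γ Λ ζ) := by
    rintro ζ c - hnb - G hGm ⟨B', hB'⟩ -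
    haveI := hγ.isProbability Λ ζ
    exact hγ.integral_integral_consistent ((hwin c).trans hnb) ζ (integrable_of_abs_le' hGm hB')
  have hU' : ∀ x, ℓ x ≠ 0 → ∀ c, x ∈ win c → c ∈ Λ ∧ nbhd c ⊆ Λ ∧ True := fun x hx c hxc =>
    ⟨(hU x hx c hxc).1, (hU x hx c hxc).2, trivial⟩
  exact abs_sub_le_of_window_geometric_exp hγ hr0 hrR hR hK0 hself hwin hKsupp hcontract hloc hγ₀ hγ₁ hsum
    Λ ω (fun _ => True) (E₁ := fun G => ∫ σ, G σ ∂(γ Λ ω)) (E₂ := fun G => ∫ σ, G σ ∂(γ Λ η))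
    (hle ω) (hge ω) (hT ω) (hle η) (hge η) (hT η) ℓ L₀ hU' hℓ hFm hB hFdep hδ hδL

end Literature.Probability.LatticeModels.DobrushinShlosman

end
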